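import Mathlib
import HarnessLib
import Literature.Analysis.FluidPDE.VectorCalculus
import Literature.Analysis.FluidPDE.PressurePoisson
import Literature.Analysis.FluidPDE.LerayProfileCalculus
import Literature.Analysis.FluidPDE.HarmonicLiouvilleLp
import Literature.Analysis.FluidPDE.TypeIAncientMildClassical
import Summits.NavierStokesRegularity.NavierStokesRegularity.Theorems.LocalTraceTubeDoorHarmonicOscillation
import Summits.NavierStokesRegularity.NavierStokesRegularity.Theorems.LocalSineTubeDoorProfileAlignedWindowRigidityAncient
import Summits.NavierStokesRegularity.NavierStokesRegularity.Theorems.PoloidalWindowDoorPoloidalWindowRigidityWindow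
import Summits.NavierStokesRegularity.NavierStokesRegularity.Theorems.PoloidalWindowDoorPoloidalWindowRigidityFlat
import Summits.NavierStokesRegularity.NavierStokesRegularity.Theorems.PoloidalWindowDoorPoloidalWindowRigidityPressureOscillation
import Summits.NavierStokesRegularity.NavierStokesRegularity.Theorems.LocalSineTubeDoorBoundedSubsolutionMaxPrinciple

/-!
# The one-window door family — door S14 `LocalTraceTubeDoor` («trace-square / harmonic-pressure door»):
# ITS PROFILE CRUX `TraceSquareProfileRigidity` PROVED — Type-I profiles with HARMONIC PRESSURE are trivial

Cell ns-regularity-ideate, seat p6 (route-directed support for nsreg-p1's door family; bears_on LADDER-NS N0; anchor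
`--supports stmt-NavierStokesRegularity-20018`, the profile-rigidity item of the family).  Door S14 of nsreg-p1
ROUND-13 (`HOME/ns-regularity-ideate-p1/r13/Sketch13.lean`, namespace `…Theses.LocalTraceTubeDoor`) reads the second
invariant of the velocity gradient, `tr((Du)²) = |S|² − ½|ω|² = −Δp`, on ONE similarity window; its residue class is
the Type-I profile class of the family (rate `‖v(t,x)‖ ≤ C/√(−t)`, continuity on the open slab, unit-viscosity
Oseen–Duhamel identity, divergence-free slices) with `tr((Dv(s))²) ≡ 0` on every slice `s < 0`, i.e. profiles whose
classical pressure is HARMONIC on every slice.  This file proves the door's profile crux (`traceSquareProfileRigidity`,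
the `TraceSquareProfileRigidity` text of Sketch13 VERBATIM) outright, WITHOUT the Oseen-kernel identity planned in
p1's S14-KIT (File 1): the canonical pressure is killed at large scales instead.

Proof.  (1) On every window `(t₀, 0)` the profile is a classical Navier–Stokes solution for some smooth pressure `p`
(`IsTypeIAncientMild.exists_isClassicalNSSolutionOn_Ioo`), and `Δp(s) = −div((v·∇)v) = −tr((Dv(s))²) = 0`
(`laplacian_pressure_eq_of_isClassicalNSSolutionOn`, `divergence_convect_self_eq`): every slice of `p` is harmonic.
(2) A harmonic function of bounded mean oscillation on the balls `B̄(y, r)`, `r ≥ 1`, has vanishing gradient at `y`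
(`…LocalTraceTubeDoorHarmonicOscillation.fderiv_eq_zero_of_harmonic_of_oscillation`); the mean-oscillation bound is
the K2 lineage's (F1) `…PressureOscillation.exists_integral_abs_sub_le_class`
(`∫_{B̄(x₀,r)} |p(s) − κ| ≤ K·C²/(−s)·|B̄(x₀,r)|`, all `r ≥ 1`, every classical pressure of a profile of the class) —
THIS is where the Oseen–Duhamel identity is consumed (the parasitic example `v = a(t)`, `p = −a′(t)·x` has harmonic
pressure and a singular apex but is not mild).  Hence `∇p ≡ 0` on the slab (`gradient_pressure_eq_zero`).  (3) So `v`
is a classical ancient solution of viscous vector BURGERS `∂ₜv + (v·∇)v = Δv`, and `q = |v|²` satisfies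
`∂ₜq + (v·∇)q − Δq = −2|Dv|²_F ≤ 0` (`…HarmonicOscillation.energyDensity_balance`); `q` is a bounded sub-solution
with bounded drift on every slab `[t₀, t₁] × ℝ³`, `t₁ < 0`, so the whole-space maximum principle
(`…BoundedSubsolutionMaxPrinciple.le_of_bounded_subsolution`) gives `|v(t₁,x)|² ≤ sup|v(t₀,·)|² ≤ C²/(−t₀) → 0` as
`t₀ → −∞` (`eq_zero_of_traceSq`).  (4) A vanishing profile is not backward-singular (`not_backwardSingular_of_zero`).

Door S14 thereby joins S10/S12/S13/S15/S16 as MOOT-BY-PROOF on the profile side; the window → slab spreading and the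
Fatou limit passage (`WindowOfProfile`, `TargetOfWindow` of Sketch13) are template work (sequel files).

WHAT THIS IS NOT: not a claim about Navier–Stokes regularity (Clay A) — the profile-rigidity half of a local
regularity CRITERION (conditional on local Type I) of the door family; «Type-I blow-up needs a non-harmonic pressure
at the blow-up scale».  Establishment in the cell's sense still requires the cross-family referee PASS + independent
reproduction.
-/

noncomputable section

-- the summit and its single sub-problem share the name (CONVENTIONS §1), as in every Theorems file
set_option linter.dupNamespace false

namespace Summit.NavierStokesRegularity.NavierStokesRegularity.Theorems.LocalTraceTubeDoorProfileRigidity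

open MeasureTheory Set Function Filter Topology TopologicalSpace Metric InnerProductSpace
open scoped RealInnerProductSpace InnerProductSpace Laplacian ContDiff
open Literature.Analysis Literature.Analysis.FluidPDE
open Summit.NavierStokesRegularity.NavierStokesRegularity.Theorems.LocalTraceTubeDoorHarmonicOscillation
open Summit.NavierStokesRegularity.NavierStokesRegularity.Theorems.LocalSineTubeDoorProfileAlignedWindowRigidityAncient
open Summit.NavierStokesRegularity.NavierStokesRegularity.Theorems.PoloidalWindowDoorPoloidalWindowRigidityWindow
open Summit.NavierStokesRegularity.NavierStokesRegularity.Theorems.PoloidalWindowDoorPoloidalWindowRigidityFlat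
open Summit.NavierStokesRegularity.NavierStokesRegularity.Theorems.PoloidalWindowDoorPoloidalWindowRigidityPressureOscillation
open Summit.NavierStokesRegularity.NavierStokesRegularity.Theorems.LocalSineTubeDoorBoundedSubsolutionMaxPrinciple

/-! ### the class: profiles with harmonic pressure -/

variable {C : ℝ} {v : ℝ → EuclideanSpace ℝ (Fin 3) → EuclideanSpace ℝ (Fin 3)}

/-- **The pressure of a profile with `tr((Dv)²) ≡ 0` is harmonic on every slice**: for any pressure making the
profile classical on a window `(t₀, 0)`, `Δp(s) = −div((v·∇)v)(s) = −tr(Dv(s) ∘ Dv(s)) = 0`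
(`laplacian_pressure_eq_of_isClassicalNSSolutionOn`, `divergence_convect_self_eq`). -/
theorem laplacian_pressure_eq_zero_of_traceSq
    (htr : ∀ s < 0, ∀ y : EuclideanSpace ℝ (Fin 3),
      LinearMap.trace ℝ (EuclideanSpace ℝ (Fin 3))
        (((fderiv ℝ (v s) y).comp (fderiv ℝ (v s) y)) :
          EuclideanSpace ℝ (Fin 3) →ₗ[ℝ] EuclideanSpace ℝ (Fin 3)) = 0)
    {t₀ : ℝ} {p : ℝ → EuclideanSpace ℝ (Fin 3) → ℝ} (hcl : IsClassicalNSSolutionOn (Ioo t₀ 0) 1 0 v p)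
    {s : ℝ} (hs : s ∈ Ioo t₀ 0) (y : EuclideanSpace ℝ (Fin 3)) : (Δ (p s)) y = 0 := by
  have hsI : s ∈ interior (Ioo t₀ 0) := by rw [isOpen_Ioo.interior_eq]; exact hs
  have hv2 : ContDiff ℝ 2 (v s) := contDiff_infty.1 (hcl.contDiff_velocity hs) 2
  rw [laplacian_pressure_eq_of_isClassicalNSSolutionOn hcl hsI y,
    divergence_convect_self_eq hv2 (hcl.divFree s hs) y, traceCLM_apply, htr s hs.2 y]
  have h0 : VectorCalculus.divergence ((0 : ℝ → EuclideanSpace ℝ (Fin 3) → EuclideanSpace ℝ (Fin 3)) s) y = 0 := by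
    rw [divergence_eq_traceCLM]
    simp
  rw [h0]
  simp

/-- **The canonical pressure of a profile with `tr((Dv)²) ≡ 0` is spatially constant**: `∇p(s) ≡ 0` on the window.
A harmonic slice (`laplacian_pressure_eq_zero_of_traceSq`) of bounded mean oscillation at all scales `r ≥ 1` — the
K2 lineage's (F1) `exists_integral_abs_sub_le_class`, which consumes the Oseen–Duhamel identity of the class — has
vanishing gradient (`fderiv_eq_zero_of_harmonic_of_oscillation`). -/
theorem gradient_pressure_eq_zero (hrate : HasTypeITimeDecay C v)
    (hmild : ∀ s t : ℝ, s < t → t < 0 → ∀ x,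
      v t x = UnboundedOperators.heatExtension (v s) (t - s) x - oseenDuhamel 1 s v v t x)
    (htr : ∀ s < 0, ∀ y : EuclideanSpace ℝ (Fin 3),
      LinearMap.trace ℝ (EuclideanSpace ℝ (Fin 3))
        (((fderiv ℝ (v s) y).comp (fderiv ℝ (v s) y)) :
          EuclideanSpace ℝ (Fin 3) →ₗ[ℝ] EuclideanSpace ℝ (Fin 3)) = 0)
    {t₀ : ℝ} (ht₀ : t₀ < 0) {p : ℝ → EuclideanSpace ℝ (Fin 3) → ℝ}
    (hcl : IsClassicalNSSolutionOn (Ioo t₀ 0) 1 0 v p)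
    {s : ℝ} (hs : s ∈ Ioo t₀ 0) (y : EuclideanSpace ℝ (Fin 3)) : gradient (p s) y = 0 := by
  -- the slice is harmonic
  have hp2 : ContDiff ℝ 2 (p s) := contDiff_infty.1 (hcl.contDiff_pressure hs) 2
  have hharm : HarmonicOnNhd (p s) univ :=
    harmonicOnNhd_of_laplacian_eq_zero hp2 fun x => laplacian_pressure_eq_zero_of_traceSq htr hcl hs x
  -- (F1): bounded mean oscillation on every ball of radius `≥ 1`
  obtain ⟨K, hK0, hF1⟩ := exists_integral_abs_sub_le_class
  have hC2 : 0 ≤ C ^ 2 / (-s) := div_nonneg (sq_nonneg C) (by linarith [hs.2])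
  have hM : 0 ≤ K * (C ^ 2 / (-s)) := mul_nonneg hK0 hC2
  have hosc : ∀ r : ℝ, 1 ≤ r → ∃ κ : ℝ, ∫ w in closedBall y r, |p s w - κ| ≤
      K * (C ^ 2 / (-s)) * volume.real (closedBall y r) := fun r hr =>
    hF1 hrate hmild ht₀ hcl s hs y r hr
  have hD : fderiv ℝ (p s) y = 0 := fderiv_eq_zero_of_harmonic_of_oscillation hharm y hM hosc
  rw [gradient, hD, map_zero]

/-- **The energy density of a profile with `tr((Dv)²) ≡ 0` is a sub-solution** of `∂ₜq + Dq(v) − Δq ≤ 0` at every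
point of the open slab (two-sided time derivative `deriv`), and `τ ↦ q(τ, x)` is differentiable there: by
`energyDensity_balance` with `∇p = 0` (`gradient_pressure_eq_zero`) the defect is `−2|Dv|²_F ≤ 0`. -/
theorem energy_subsolution_of_traceSq (hrate : HasTypeITimeDecay C v)
    (hcont : ContinuousOn (uncurry v) (Iio (0 : ℝ) ×ˢ univ))
    (hmild : ∀ s t : ℝ, s < t → t < 0 → ∀ x,
      v t x = UnboundedOperators.heatExtension (v s) (t - s) x - oseenDuhamel 1 s v v t x)
    (hdiv : ∀ t < 0, VectorCalculus.IsDivFree (v t))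
    (htr : ∀ s < 0, ∀ y : EuclideanSpace ℝ (Fin 3),
      LinearMap.trace ℝ (EuclideanSpace ℝ (Fin 3))
        (((fderiv ℝ (v s) y).comp (fderiv ℝ (v s) y)) :
          EuclideanSpace ℝ (Fin 3) →ₗ[ℝ] EuclideanSpace ℝ (Fin 3)) = 0)
    {t : ℝ} (ht : t < 0) (x : EuclideanSpace ℝ (Fin 3)) :
    HasDerivAt (fun τ => ⟪v τ x, v τ x⟫_ℝ) (deriv (fun τ => ⟪v τ x, v τ x⟫_ℝ) t) t ∧
      deriv (fun τ => ⟪v τ x, v τ x⟫_ℝ) t +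
          fderiv ℝ (fun y => ⟪v t y, v t y⟫_ℝ) x (v t x) -
          (Δ (fun y => ⟪v t y, v t y⟫_ℝ)) x ≤ 0 := by
  have hA : IsTypeIAncientMild C v := isTypeIAncientMild_of_class hrate hcont hmild hdiv
  have ht₀ : t - 1 < 0 := by linarith
  have htI : t ∈ Ioo (t - 1) 0 := ⟨by linarith, ht⟩
  obtain ⟨p, hcl⟩ := hA.exists_isClassicalNSSolutionOn_Ioo ht₀
  have hbal := energyDensity_balance isOpen_Ioo hcl htI x
  have hgrad : gradient (p t) x = 0 := gradient_pressure_eq_zero hrate hmild htr ht₀ hcl htI x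
  -- the time derivative within the open window is the two-sided derivative
  have hdu : HasDerivWithinAt (fun τ => v τ x) (timeDerivWithin (Ioo (t - 1) 0) v t x) (Ioo (t - 1) 0) t := by
    rw [timeDerivWithin_apply]
    exact (hcl.smooth_velocity.differentiableWithinAt_time htI x).hasDerivWithinAt
  have hq : HasDerivAt (fun τ => ⟪v τ x, v τ x⟫_ℝ)
      (⟪v t x, timeDerivWithin (Ioo (t - 1) 0) v t x⟫_ℝ +
        ⟪timeDerivWithin (Ioo (t - 1) 0) v t x, v t x⟫_ℝ) t :=
    (hdu.inner ℝ hdu).hasDerivAt (isOpen_Ioo.mem_nhds htI)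
  refine ⟨hq.differentiableAt.hasDerivAt, ?_⟩
  have hderiv : deriv (fun τ => ⟪v τ x, v τ x⟫_ℝ) t =
      timeDerivWithin (Ioo (t - 1) 0) (fun τ y => ⟪v τ y, v τ y⟫_ℝ) t x := by
    rw [timeDerivWithin_apply, derivWithin_of_isOpen isOpen_Ioo htI]
  rw [hderiv]
  have h1 : (1 : ℝ) * (Δ (fun y => ⟪v t y, v t y⟫_ℝ)) x = (Δ (fun y => ⟪v t y, v t y⟫_ℝ)) x := one_mul _
  rw [← h1, hbal, hgrad, inner_zero_right]
  have := frobeniusNormSq_nonneg (fderiv ℝ (v t) x)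
  linarith

/-- **TYPE-I PROFILES WITH `tr((Dv)²) ≡ 0` (HARMONIC PRESSURE) ARE TRIVIAL**: the energy density is a bounded
sub-solution on every slab `[t₀, t₁] × ℝ³`, `t₁ < 0` (drift `v` bounded by the rate, `q ≤ C²/(−t₁)`), so by the
whole-space maximum principle `|v(t₁, x)|² ≤ sup |v(t₀, ·)|² ≤ C²/(−t₀)`, which tends to `0` as `t₀ → −∞`. -/
theorem eq_zero_of_traceSq (hrate : HasTypeITimeDecay C v)
    (hcont : ContinuousOn (uncurry v) (Iio (0 : ℝ) ×ˢ univ))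
    (hmild : ∀ s t : ℝ, s < t → t < 0 → ∀ x,
      v t x = UnboundedOperators.heatExtension (v s) (t - s) x - oseenDuhamel 1 s v v t x)
    (hdiv : ∀ t < 0, VectorCalculus.IsDivFree (v t))
    (htr : ∀ s < 0, ∀ y : EuclideanSpace ℝ (Fin 3),
      LinearMap.trace ℝ (EuclideanSpace ℝ (Fin 3))
        (((fderiv ℝ (v s) y).comp (fderiv ℝ (v s) y)) :
          EuclideanSpace ℝ (Fin 3) →ₗ[ℝ] EuclideanSpace ℝ (Fin 3)) = 0) :
    ∀ t < 0, ∀ x, v t x = 0 := by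
  have hA : IsTypeIAncientMild C v := isTypeIAncientMild_of_class hrate hcont hmild hdiv
  have hC0 : 0 ≤ C := by
    have h := hrate (-1) (by norm_num) 0
    rw [neg_neg, Real.sqrt_one, div_one] at h
    exact (norm_nonneg _).trans h
  -- the energy density and its time derivative
  set q : ℝ → EuclideanSpace ℝ (Fin 3) → ℝ := fun τ y => ⟪v τ y, v τ y⟫_ℝ with hqdef
  set qt : ℝ → EuclideanSpace ℝ (Fin 3) → ℝ := fun τ y => deriv (fun τ' => q τ' y) τ with hqtdef
  have hsm : IsSmoothSpaceTimeOn (Iio 0) v := hA.contDiffOn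
  intro t₁ ht₁ x₁
  -- `q(t₁, x₁) ≤ C²/(−t₀)` for every `t₀ < t₁`
  have hkey : ∀ t₀ < t₁, q t₁ x₁ ≤ C ^ 2 / (-t₀) := by
    intro t₀ ht₀
    -- drift bound on `[t₀, t₁]`
    obtain ⟨B, hB⟩ := bdd_of_hasTypeITimeDecay hrate (-t₁ / 2) (by linarith)
    have hbA : ∀ t ∈ Icc t₀ t₁, ∀ x, ‖v t x‖ ≤ B := fun t ht x => hB t (by linarith [ht.2]) x
    -- continuity of `q` on the closed slab
    have hq_c : ContinuousOn (uncurry q) (Icc t₀ t₁ ×ˢ univ) := by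
      have hvc : ContinuousOn (uncurry v) (Icc t₀ t₁ ×ˢ univ) :=
        hsm.continuousOn.mono (prod_mono (fun t ht => lt_of_le_of_lt ht.2 ht₁) Subset.rfl)
      have h : ContinuousOn (fun z => ⟪uncurry v z, uncurry v z⟫_ℝ) (Icc t₀ t₁ ×ˢ univ) := hvc.inner hvc
      refine h.congr fun z _ => ?_
      simp only [hqdef, uncurry]
    -- smooth slices
    have hq2 : ∀ t ∈ Icc t₀ t₁, ContDiff ℝ 2 (q t) := fun t ht => by
      have htn : t < 0 := lt_of_le_of_lt ht.2 ht₁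
      have hV : ContDiff ℝ 2 (v t) :=
        (analyticOnNhd_slice hcont (bdd_of_hasTypeITimeDecay hrate) hmild htn).contDiff
      exact hV.inner ℝ hV
    -- time derivative and the sub-solution inequality
    have hsub := fun t (ht : t ∈ Icc t₀ t₁) x =>
      energy_subsolution_of_traceSq hrate hcont hmild hdiv htr (lt_of_le_of_lt ht.2 ht₁) x
    have hqt : ∀ x, ∀ t ∈ Icc t₀ t₁, HasDerivAt (fun τ => q τ x) (qt t x) t := fun x t ht => (hsub t ht x).1
    have hlaw : ∀ t ∈ Icc t₀ t₁, ∀ x, qt t x + fderiv ℝ (q t) x (v t x) - (Δ (q t)) x ≤ 0 :=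
      fun t ht x => (hsub t ht x).2
    -- bounds
    have hqbd : ∀ t < 0, ∀ x, q t x ≤ C ^ 2 / (-t) := fun t ht x => by
      simp only [hqdef, real_inner_self_eq_norm_sq]
      have h1 := hrate t ht x
      have hst : 0 < Real.sqrt (-t) := Real.sqrt_pos.2 (by linarith)
      have h2 : ‖v t x‖ ^ 2 ≤ (C / Real.sqrt (-t)) ^ 2 := pow_le_pow_left₀ (norm_nonneg _) h1 2
      rw [div_pow, Real.sq_sqrt (by linarith)] at h2
      exact h2
    have hbdd : ∀ t ∈ Icc t₀ t₁, ∀ x, |q t x| ≤ C ^ 2 / (-t₁) := fun t ht x => by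
      have htn : t < 0 := lt_of_le_of_lt ht.2 ht₁
      have hq0 : 0 ≤ q t x := by simp only [hqdef]; exact real_inner_self_nonneg
      rw [abs_of_nonneg hq0]
      refine (hqbd t htn x).trans ?_
      exact div_le_div_of_nonneg_left (sq_nonneg C) (by linarith) (by linarith [ht.2])
    have hinit : ∀ x, q t₀ x ≤ C ^ 2 / (-t₀) := fun x => hqbd t₀ (ht₀.trans ht₁) x
    exact le_of_bounded_subsolution ht₀ hbA hq_c hq2 hqt hlaw hbdd hinit t₁ ⟨ht₀.le, le_rfl⟩ x₁
  -- let `t₀ → −∞`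
  have hq0 : 0 ≤ q t₁ x₁ := by simp only [hqdef]; exact real_inner_self_nonneg
  have hqle : q t₁ x₁ ≤ 0 := by
    refine le_of_forall_pos_le_add fun η hη => ?_
    -- choose `t₀` with `C²/(−t₀) ≤ η`, e.g. `t₀ = t₁ − 1 − C²/η`
    set t₀ : ℝ := t₁ - 1 - C ^ 2 / η with ht₀def
    have hq' : 0 ≤ C ^ 2 / η := div_nonneg (sq_nonneg C) hη.le
    have ht₀ : t₀ < t₁ := by rw [ht₀def]; linarith
    have hnt₀ : C ^ 2 / η ≤ -t₀ := by rw [ht₀def]; linarith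
    have hpos : 0 < -t₀ := by linarith
    have h1 : C ^ 2 / (-t₀) ≤ η := by
      rw [div_le_iff₀ hpos]
      calc C ^ 2 = C ^ 2 / η * η := by field_simp
        _ ≤ -t₀ * η := mul_le_mul_of_nonneg_right hnt₀ hη.le
        _ = η * -t₀ := mul_comm _ _
    linarith [hkey t₀ ht₀]
  have hq00 : q t₁ x₁ = 0 := le_antisymm hqle hq0
  simpa only [hqdef, inner_self_eq_zero] using hq00

/-- **The harmonic-pressure stratum of the family's profile class is settled**: such a profile is not
backward-singular. -/
theorem not_backwardSingular_of_traceSq (hrate : HasTypeITimeDecay C v)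
    (hcont : ContinuousOn (uncurry v) (Iio (0 : ℝ) ×ˢ univ))
    (hmild : ∀ s t : ℝ, s < t → t < 0 → ∀ x,
      v t x = UnboundedOperators.heatExtension (v s) (t - s) x - oseenDuhamel 1 s v v t x)
    (hdiv : ∀ t < 0, VectorCalculus.IsDivFree (v t))
    (htr : ∀ s < 0, ∀ y : EuclideanSpace ℝ (Fin 3),
      LinearMap.trace ℝ (EuclideanSpace ℝ (Fin 3))
        (((fderiv ℝ (v s) y).comp (fderiv ℝ (v s) y)) :
          EuclideanSpace ℝ (Fin 3) →ₗ[ℝ] EuclideanSpace ℝ (Fin 3)) = 0) :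
    ¬ IsBackwardSingularPoint v 0 :=
  not_backwardSingular_of_zero (eq_zero_of_traceSq hrate hcont hmild hdiv htr)

/-- **THE PROFILE CRUX OF DOOR S14 (`…Theses.LocalTraceTubeDoor.TraceSquareProfileRigidity`, nsreg-p1 r13/Sketch13,
VERBATIM), PROVED.**  A profile of the Type-I class (rate, continuity, unit-viscosity Oseen–Duhamel identity,
divergence-free slices) on which `tr((Dv(s))²) = 0` identically on every slice `s < 0` (equivalently: its classical
pressure is harmonic on every slice) is not backward-singular at the apex. -/
theorem traceSquareProfileRigidity :
    ∀ (C : ℝ) (v : ℝ → EuclideanSpace ℝ (Fin 3) → EuclideanSpace ℝ (Fin 3)),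
    Literature.Analysis.FluidPDE.HasTypeITimeDecay C v →
    ContinuousOn (Function.uncurry v) (Set.Iio (0 : ℝ) ×ˢ Set.univ) →
    (∀ s t : ℝ, s < t → t < 0 → ∀ x, v t x =
      Literature.Analysis.UnboundedOperators.heatExtension (v s) (t - s) x -
        Literature.Analysis.FluidPDE.oseenDuhamel 1 s v v t x) →
    (∀ t < 0, Literature.Analysis.FluidPDE.VectorCalculus.IsDivFree (v t)) →
    (∀ s < 0, ∀ y : EuclideanSpace ℝ (Fin 3),
      LinearMap.trace ℝ (EuclideanSpace ℝ (Fin 3))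
        (((fderiv ℝ (v s) y).comp (fderiv ℝ (v s) y)) :
          EuclideanSpace ℝ (Fin 3) →ₗ[ℝ] EuclideanSpace ℝ (Fin 3)) = 0) →
    ¬ Literature.Analysis.FluidPDE.IsBackwardSingularPoint v 0 := by
  intro C v hrate hcont hmild hdiv htr
  exact not_backwardSingular_of_traceSq hrate hcont hmild hdiv htr

/-! ### window → slab for the trace-square density -/

/-- **The trace-square density `y ↦ tr(Dv(s)(y) ∘ Dv(s)(y))` of a slice of a profile of the class is real-analytic**
(slice analyticity `analyticOnNhd_slice`, `AnalyticOnNhd.fderiv`, composition bilinear, trace linear). -/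
theorem analyticOnNhd_traceSq_slice (hrate : HasTypeITimeDecay C v)
    (hcont : ContinuousOn (uncurry v) (Iio (0 : ℝ) ×ˢ univ))
    (hmild : ∀ s t : ℝ, s < t → t < 0 → ∀ x,
      v t x = UnboundedOperators.heatExtension (v s) (t - s) x - oseenDuhamel 1 s v v t x)
    {s : ℝ} (hs : s < 0) :
    AnalyticOnNhd ℝ (fun y => LinearMap.trace ℝ (EuclideanSpace ℝ (Fin 3))
      (((fderiv ℝ (v s) y).comp (fderiv ℝ (v s) y)) :
        EuclideanSpace ℝ (Fin 3) →ₗ[ℝ] EuclideanSpace ℝ (Fin 3))) univ := by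
  have hslice := analyticOnNhd_slice hcont (bdd_of_hasTypeITimeDecay hrate) hmild hs
  intro y hy
  have hcomp : AnalyticAt ℝ (fun y => (fderiv ℝ (v s) y).comp (fderiv ℝ (v s) y)) y :=
    ((ContinuousLinearMap.compL ℝ (EuclideanSpace ℝ (Fin 3)) (EuclideanSpace ℝ (Fin 3))
      (EuclideanSpace ℝ (Fin 3))).analyticAt_bilinear (fderiv ℝ (v s) y, fderiv ℝ (v s) y)).comp₂
      (hslice.fderiv y hy) (hslice.fderiv y hy)
  have htr : AnalyticAt ℝ (fun y => traceCLM ((fderiv ℝ (v s) y).comp (fderiv ℝ (v s) y))) y :=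
    ((traceCLM (E := EuclideanSpace ℝ (Fin 3))).analyticAt _).comp hcomp
  exact htr

/-- **Window → slab for the trace-square density**: for a profile of the class, if at every `s < 0` the density
`tr((Dv(s))²)` vanishes on some nonempty open window, it vanishes on every slice (identity theorem,
`real_eq_zero_spread`). -/
theorem traceSqWindowToSlab (hrate : HasTypeITimeDecay C v)
    (hcont : ContinuousOn (uncurry v) (Iio (0 : ℝ) ×ˢ univ))
    (hmild : ∀ s t : ℝ, s < t → t < 0 → ∀ x,
      v t x = UnboundedOperators.heatExtension (v s) (t - s) x - oseenDuhamel 1 s v v t x)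
    (hwin : ∀ s < 0, ∃ U : Set (EuclideanSpace ℝ (Fin 3)), IsOpen U ∧ U.Nonempty ∧ ∀ y ∈ U,
      LinearMap.trace ℝ (EuclideanSpace ℝ (Fin 3))
        (((fderiv ℝ (v s) y).comp (fderiv ℝ (v s) y)) :
          EuclideanSpace ℝ (Fin 3) →ₗ[ℝ] EuclideanSpace ℝ (Fin 3)) = 0) :
    ∀ s < 0, ∀ y : EuclideanSpace ℝ (Fin 3),
      LinearMap.trace ℝ (EuclideanSpace ℝ (Fin 3))
        (((fderiv ℝ (v s) y).comp (fderiv ℝ (v s) y)) :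
          EuclideanSpace ℝ (Fin 3) →ₗ[ℝ] EuclideanSpace ℝ (Fin 3)) = 0 := by
  intro s hs
  obtain ⟨U, hU, hne, hal⟩ := hwin s hs
  obtain ⟨y₀, hy₀⟩ := hne
  have hg := analyticOnNhd_traceSq_slice hrate hcont hmild hs
  have hev : (fun y => LinearMap.trace ℝ (EuclideanSpace ℝ (Fin 3))
      (((fderiv ℝ (v s) y).comp (fderiv ℝ (v s) y)) :
        EuclideanSpace ℝ (Fin 3) →ₗ[ℝ] EuclideanSpace ℝ (Fin 3))) =ᶠ[𝓝 y₀] 0 :=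
    Filter.eventually_of_mem (hU.mem_nhds hy₀) fun y hy => hal y hy
  intro y
  exact hg.eqOn_zero_of_preconnected_of_eventuallyEq_zero isPreconnected_univ (mem_univ y₀) hev (mem_univ y)

/-- **THE PROFILE WINDOW FORM OF DOOR S14 (`…Theses.LocalTraceTubeDoor.TraceSquareWindowRigidity`, nsreg-p1
r13/Sketch13, VERBATIM), PROVED**: a profile of the Type-I class whose trace-square density `tr((Dv(s))²)` vanishes on
SOME nonempty open window of every slice `s < 0` is not backward-singular at the apex. -/
theorem traceSquareWindowRigidity :
    ∀ (C : ℝ) (v : ℝ → EuclideanSpace ℝ (Fin 3) → EuclideanSpace ℝ (Fin 3)),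
    Literature.Analysis.FluidPDE.HasTypeITimeDecay C v →
    ContinuousOn (Function.uncurry v) (Set.Iio (0 : ℝ) ×ˢ Set.univ) →
    (∀ s t : ℝ, s < t → t < 0 → ∀ x, v t x =
      Literature.Analysis.UnboundedOperators.heatExtension (v s) (t - s) x -
        Literature.Analysis.FluidPDE.oseenDuhamel 1 s v v t x) →
    (∀ t < 0, Literature.Analysis.FluidPDE.VectorCalculus.IsDivFree (v t)) →
    (∀ s < 0, ∃ U : Set (EuclideanSpace ℝ (Fin 3)), IsOpen U ∧ U.Nonempty ∧ ∀ y ∈ U,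
      LinearMap.trace ℝ (EuclideanSpace ℝ (Fin 3))
        (((fderiv ℝ (v s) y).comp (fderiv ℝ (v s) y)) :
          EuclideanSpace ℝ (Fin 3) →ₗ[ℝ] EuclideanSpace ℝ (Fin 3)) = 0) →
    ¬ Literature.Analysis.FluidPDE.IsBackwardSingularPoint v 0 := by
  intro C v hrate hcont hmild hdiv hwin
  exact not_backwardSingular_of_traceSq hrate hcont hmild hdiv (traceSqWindowToSlab hrate hcont hmild hwin)

/-- **Support `WindowOfProfile` of door S14 (Sketch13: `TraceSquareProfileRigidity → TraceSquareWindowRigidity`), in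
substance**: the window form holds outright (the implication is then trivial; stated here with both texts verbatim so
that a born route's support item closes by `fun _ => traceSquareWindowRigidity`). -/
theorem windowOfProfile :
    (∀ (C : ℝ) (v : ℝ → EuclideanSpace ℝ (Fin 3) → EuclideanSpace ℝ (Fin 3)),
      Literature.Analysis.FluidPDE.HasTypeITimeDecay C v →
      ContinuousOn (Function.uncurry v) (Set.Iio (0 : ℝ) ×ˢ Set.univ) →
      (∀ s t : ℝ, s < t → t < 0 → ∀ x, v t x =
        Literature.Analysis.UnboundedOperators.heatExtension (v s) (t - s) x -
          Literature.Analysis.FluidPDE.oseenDuhamel 1 s v v t x) →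
      (∀ t < 0, Literature.Analysis.FluidPDE.VectorCalculus.IsDivFree (v t)) →
      (∀ s < 0, ∀ y : EuclideanSpace ℝ (Fin 3),
        LinearMap.trace ℝ (EuclideanSpace ℝ (Fin 3))
          (((fderiv ℝ (v s) y).comp (fderiv ℝ (v s) y)) :
            EuclideanSpace ℝ (Fin 3) →ₗ[ℝ] EuclideanSpace ℝ (Fin 3)) = 0) →
      ¬ Literature.Analysis.FluidPDE.IsBackwardSingularPoint v 0) →
    (∀ (C : ℝ) (v : ℝ → EuclideanSpace ℝ (Fin 3) → EuclideanSpace ℝ (Fin 3)),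
      Literature.Analysis.FluidPDE.HasTypeITimeDecay C v →
      ContinuousOn (Function.uncurry v) (Set.Iio (0 : ℝ) ×ˢ Set.univ) →
      (∀ s t : ℝ, s < t → t < 0 → ∀ x, v t x =
        Literature.Analysis.UnboundedOperators.heatExtension (v s) (t - s) x -
          Literature.Analysis.FluidPDE.oseenDuhamel 1 s v v t x) →
      (∀ t < 0, Literature.Analysis.FluidPDE.VectorCalculus.IsDivFree (v t)) →
      (∀ s < 0, ∃ U : Set (EuclideanSpace ℝ (Fin 3)), IsOpen U ∧ U.Nonempty ∧ ∀ y ∈ U,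
        LinearMap.trace ℝ (EuclideanSpace ℝ (Fin 3))
          (((fderiv ℝ (v s) y).comp (fderiv ℝ (v s) y)) :
            EuclideanSpace ℝ (Fin 3) →ₗ[ℝ] EuclideanSpace ℝ (Fin 3)) = 0) →
      ¬ Literature.Analysis.FluidPDE.IsBackwardSingularPoint v 0) :=
  fun _ => traceSquareWindowRigidity

end Summit.NavierStokesRegularity.NavierStokesRegularity.Theorems.LocalTraceTubeDoorProfileRigidity

end
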